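/- Width seat `ym-line-sfw-p2-w5` (prover-ym-line-sfw-p2-w5-g18-0), free hands on planner ym-idea-2 g16's LINE-19 task board (STUB-PLAN-S4b §10,
toward the FREE item T5 = the S4b assembly; crux `AllWindowsColdBox.BoxHighWindowsSU22` = stmt-QuantumFields-24004 / 24335, stub S4b):
the plaquette functional `λ_p` applied to an edge function = the signed sum over the four plaquette links (the input form of T3). -/
import Summits.QuantumFields.YangMills.Theorems.AllWindowsColdBoxBoxHighLineLandauDivergence

/-!
# LINE-19 S4b §10, second brick of the assembly T5: `λ_p · a = a(y,i) + a(y+e_i,j) − a(y+e_j,i) − a(y,j)`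

In the bootstrap, T2 (`hodgeRepresentation′`) expresses the su(2)-coordinate one-form through the plaquette circulations `λ_p · a`, and T3
(`quaternionBCH`) controls the signed sum of the su(2)-coordinates of the four links of a plaquette by the plaquette holonomy.  This file supplies the
bookkeeping identity between the two:

* `mem_boxEdgesAt_of_mem_boxEdges` : a cold-box edge is an edge of the enlarged block (so it is a `LandauFree` variable);
* `sum_ite_edge_eq` : for an edge function `f` vanishing off the cold box, `Σ_{e free} [e = E]·f(e) = f(E)` for EVERY edge `E`;
* **`landauCoeff_dotProduct_eq`** : `λ_p · (f ∘ edge) = f(p.1, i) + f(p.1 + e_i, j) − f(p.1 + e_j, i) − f(p.1, j)` (`p = (y, i, j)`) for such `f`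
  (`LatticeMaxwell.coeff`/`coeffAux`);
* `not_mem_interior_of_not_mem_boxEdges` : both endpoints of a non-box edge are non-interior sites, hence
  `gaugeTransformZd_eq_one_of_not_mem_boxEdges` : for a cold-wall `U` and an interior gauge transform `g`, `(U^g)_E = 1` off the cold box, and
  `imVec_gaugeTransform_eq_zero_of_not_mem_boxEdges`; so `landauCoeff_dotProduct_imVec_gaugeTransform` :
  `λ_p · (imVec ∘ U^g)_c = imVec(W(y,i))_c + imVec(W(y+e_i,j))_c − imVec(W(y+e_j,i))_c − imVec(W(y,j))_c`, `W = U^g`.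

Everything proved; no definition; standard axioms.  HONEST LABEL: a helper toward ONE registered stub (S4b) of a critic-PASSed line on the R2ξ″
RECORD-rung crux 24004 / 24335; no stub is proved by name, no crux, rung or summit is proved; the Yang–Mills mass gap is NOT proved by this file.
-/

set_option autoImplicit false

noncomputable section

open Finset Matrix
open Literature.MathematicalPhysics.QuantumFieldTheory
open Literature.MathematicalPhysics.QuantumFieldTheory.LatticeMaxwell
open Literature.MathematicalPhysics.QuantumFieldTheory.AxialGauge
open Summit.QuantumFields.YangMills.Theorems.WeakCouplingRates
open Literature.Probability.LatticeModels (Site)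
open Literature.MathematicalPhysics.QuantumLattice (LGConfig gaugeTransformZd)

namespace Summit.QuantumFields.YangMills.Theorems.AllWindowsColdBoxBoxHighLine

/-! ## Free edges and indicator sums -/

/-- A cold-box edge is an edge of the enlarged block `dirCorner + {0,…,2H+2}⁴`. -/
theorem mem_boxEdgesAt_of_mem_boxEdges {H : ℕ} {E : Literature.MathematicalPhysics.QuantumLattice.ZdEdge 4} (hE : E ∈ boxEdges 4 (2 * H + 1)) :
    E ∈ boxEdgesAt dirCorner (2 * H + 3) := by
  obtain ⟨x, μ⟩ := E
  rw [mem_boxEdges_iff] at hE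
  rw [LatticeMaxwell.mem_boxEdgesAt, mem_boxEdges_iff]
  simp only [Pi.sub_apply, dirCorner]
  refine ⟨fun k => ?_, ?_⟩
  · have := hE.1 k; push_cast; constructor <;> omega
  · have := hE.2; push_cast; omega

/-- **Indicator sums over the free edges**: if `f` vanishes off the cold box then `Σ_{e free} [e = E]·f(e) = f(E)` for every edge `E`. -/
theorem sum_ite_edge_eq {H : ℕ} (f : Literature.MathematicalPhysics.QuantumLattice.ZdEdge 4 → ℝ) (hf : ∀ E, E ∉ boxEdges 4 (2 * H + 1) → f E = 0) (E : Literature.MathematicalPhysics.QuantumLattice.ZdEdge 4) :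
    ∑ e : LandauFree H, (if e.1.1 = E then (1 : ℝ) else 0) * f e.1.1 = f E := by
  classical
  by_cases hE : E ∈ boxEdges 4 (2 * H + 1)
  · -- the unique free edge over `E`
    let e₀ : LandauFree H := ⟨⟨E, mem_boxEdgesAt_of_mem_boxEdges hE⟩, fun h => h hE⟩
    rw [Finset.sum_eq_single e₀]
    · have he : (e₀ : LandauFree H).1.1 = E := rfl
      rw [if_pos he, he, one_mul]
    · intro e _ hne
      have : e.1.1 ≠ E := fun h => hne (Subtype.ext (Subtype.ext h))
      rw [if_neg this, zero_mul]
    · intro h; exact absurd (Finset.mem_univ _) h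
  · rw [hf E hE]
    refine Finset.sum_eq_zero fun e _ => ?_
    have hne : e.1.1 ≠ E := by
      intro h
      apply e.2
      show e.1.1 ∉ boxEdges 4 (2 * H + 1)
      rw [h]; exact hE
    rw [if_neg hne, zero_mul]

/-- **The plaquette functional on an edge function vanishing off the cold box**:
`λ_p · (f ∘ edge) = f(y,i) + f(y+e_i,j) − f(y+e_j,i) − f(y,j)` for `p = (y,i,j)`. -/
theorem landauCoeff_dotProduct_eq {H : ℕ} (p : Plaq 4) (f : Literature.MathematicalPhysics.QuantumLattice.ZdEdge 4 → ℝ) (hf : ∀ E, E ∉ boxEdges 4 (2 * H + 1) → f E = 0) :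
    landauCoeff H p ⬝ᵥ (fun e : LandauFree H => f e.1.1) =
      f (p.1, p.2.1) + f (p.1 + Pi.single p.2.1 1, p.2.2) - f (p.1 + Pi.single p.2.2 1, p.2.1) - f (p.1, p.2.2) := by
  classical
  have h1 := sum_ite_edge_eq f hf (p.1, p.2.1)
  have h2 := sum_ite_edge_eq f hf (p.1 + Pi.single p.2.1 1, p.2.2)
  have h3 := sum_ite_edge_eq f hf (p.1 + Pi.single p.2.2 1, p.2.1)
  have h4 := sum_ite_edge_eq f hf (p.1, p.2.2)
  simp only [dotProduct, landauCoeff, LatticeMaxwell.coeff, LatticeMaxwell.coeffAux]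
  have hsplit : ∀ e : LandauFree H,
      ((if e.1.1 = (p.1, p.2.1) then (1 : ℝ) else 0) + (if e.1.1 = (p.1 + Pi.single p.2.1 1, p.2.2) then 1 else 0) -
        (if e.1.1 = (p.1 + Pi.single p.2.2 1, p.2.1) then 1 else 0) - (if e.1.1 = (p.1, p.2.2) then 1 else 0)) * f e.1.1 =
      (if e.1.1 = (p.1, p.2.1) then (1 : ℝ) else 0) * f e.1.1 + (if e.1.1 = (p.1 + Pi.single p.2.1 1, p.2.2) then (1 : ℝ) else 0) * f e.1.1 -
        (if e.1.1 = (p.1 + Pi.single p.2.2 1, p.2.1) then (1 : ℝ) else 0) * f e.1.1 - (if e.1.1 = (p.1, p.2.2) then (1 : ℝ) else 0) * f e.1.1 :=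
    fun e => by ring
  simp_rw [hsplit]
  rw [Finset.sum_sub_distrib, Finset.sum_sub_distrib, Finset.sum_add_distrib, h1, h2, h3, h4]

/-! ## Cold wall + interior gauge: the links off the cold box are `1` -/

/-- Both endpoints of a non-box edge are non-interior sites. -/
theorem not_mem_interior_of_not_mem_boxEdges {H : ℕ} {E : Literature.MathematicalPhysics.QuantumLattice.ZdEdge 4} (hE : E ∉ boxEdges 4 (2 * H + 1)) :
    E.1 ∉ interiorSites H ∧ E.1 + Pi.single E.2 1 ∉ interiorSites H := by
  obtain ⟨x, μ⟩ := E
  rw [mem_boxEdges_iff] at hE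
  show x ∉ interiorSites H ∧ x + Pi.single μ 1 ∉ interiorSites H
  constructor
  · intro hx
    apply hE
    have hb := interior_bounds hx
    refine ⟨fun k => ?_, ?_⟩
    · have := hb k; push_cast; constructor <;> omega
    · have := hb μ; push_cast; omega
  · intro hx
    apply hE
    have hb := interior_bounds hx
    have hk : ∀ k : Fin 4, (x + Pi.single μ 1 : Site 4) k = x k + if k = μ then 1 else 0 := fun k => by
      simp [Pi.add_apply, Pi.single_apply]
    refine ⟨fun k => ?_, ?_⟩
    · have := hb k; rw [hk k] at this; split_ifs at this <;> push_cast <;> constructor <;> omega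
    · have := hb μ; rw [hk μ, if_pos rfl] at this; push_cast; omega

/-- For a cold-wall configuration and an interior gauge transform, the transformed links off the cold box are `1`. -/
theorem gaugeTransformZd_eq_one_of_not_mem_boxEdges {H : ℕ} {U : LGConfig 4 SU2} (hU : ColdWall H U) {g : Site 4 → SU2}
    (hg : IsInteriorGauge H g) {E : Literature.MathematicalPhysics.QuantumLattice.ZdEdge 4} (hE : E ∉ boxEdges 4 (2 * H + 1)) : gaugeTransformZd g U E = 1 := by
  obtain ⟨h1, h2⟩ := not_mem_interior_of_not_mem_boxEdges hE
  unfold Literature.MathematicalPhysics.QuantumLattice.gaugeTransformZd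
  rw [hg _ h1, hU E hE, hg _ h2]
  simp

/-- The su(2)-coordinates of the identity vanish. -/
theorem imVec_one (c : Fin 3) : imVec (1 : SU2) c = 0 := by
  rw [imVec_eq_imVecM]
  have : ((1 : SU2) : Matrix (Fin 2) (Fin 2) ℂ) = 1 := rfl
  rw [this, imVecM_one]
  rfl

/-- Hence the su(2)-coordinates of the transformed configuration vanish off the cold box. -/
theorem imVec_gaugeTransform_eq_zero_of_not_mem_boxEdges {H : ℕ} {U : LGConfig 4 SU2} (hU : ColdWall H U) {g : Site 4 → SU2}
    (hg : IsInteriorGauge H g) (c : Fin 3) {E : Literature.MathematicalPhysics.QuantumLattice.ZdEdge 4} (hE : E ∉ boxEdges 4 (2 * H + 1)) :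
    imVec (gaugeTransformZd g U E) c = 0 := by
  rw [gaugeTransformZd_eq_one_of_not_mem_boxEdges hU hg hE, imVec_one]

/-- **The plaquette functional of the su(2)-coordinate one-form of `W = U^g`** (cold wall, interior gauge):
`λ_p · (imVec ∘ W)_c = imVec(W(y,i))_c + imVec(W(y+e_i,j))_c − imVec(W(y+e_j,i))_c − imVec(W(y,j))_c` — the signed sum of T3. -/
theorem landauCoeff_dotProduct_imVec_gaugeTransform {H : ℕ} {U : LGConfig 4 SU2} (hU : ColdWall H U) {g : Site 4 → SU2}
    (hg : IsInteriorGauge H g) (p : Plaq 4) (c : Fin 3) :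
    landauCoeff H p ⬝ᵥ (fun e : LandauFree H => imVec (gaugeTransformZd g U e.1.1) c) =
      imVec (gaugeTransformZd g U (p.1, p.2.1)) c + imVec (gaugeTransformZd g U (p.1 + Pi.single p.2.1 1, p.2.2)) c -
        imVec (gaugeTransformZd g U (p.1 + Pi.single p.2.2 1, p.2.1)) c - imVec (gaugeTransformZd g U (p.1, p.2.2)) c :=
  landauCoeff_dotProduct_eq p (fun E => imVec (gaugeTransformZd g U E) c)
    (fun _ hE => imVec_gaugeTransform_eq_zero_of_not_mem_boxEdges hU hg c hE)

end Summit.QuantumFields.YangMills.Theorems.AllWindowsColdBoxBoxHighLine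

end
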